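import Literature.AnabelianGeometry.EtaleTheta.Discharge.Sec5Thm57HK4famEOfProducedShadowHsepPow
import Literature.AnabelianGeometry.EtaleTheta.Discharge.Sec5Thm57K4mAtSettingTowerOfShadow
import Literature.AnabelianGeometry.EtaleTheta.Discharge.Sec5Thm57GammaMuDescentLaws
import Literature.AnabelianGeometry.EtaleTheta.Discharge.Sec5ThetaSubquotientRhoOfConnectedTemperoid

/-!
# [EtTh] §5, Theorem 5.7 (C)-display — the member binder `hK4famE′` FROM THE K4 JUNCTION BOOK BY NAME and the shadow law (3):
# (K4m) at `b` at every coherent member of the tower of the Setting (Thm 5.7 proof p.330; Thm 5.6 p.328–329)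

Mochizuki, *The étale theta function and its Frobenioid-theoretic manifestations*, Publ. RIMS **45** (2009)
[cite: MochizukiEtTh2009, Thm 5.7 proof p.330 (PDF p.104); Thm 5.6 p.328–329 (PDF pp.102–103); Cor 2.18 (i) p.286 (PDF p.60); Def 5.4 p.327 (PDF
p.101)].  abc-iut cell, layer L2, node `EtTh:Thm5.7`; seat abc-iut-f-123 (gen 9), abc-iut-L2-lead R1311/R1325/R1359 «THM57-RESIDUAL-(3)», FILE 2a
of the «BY-NAME» display.  PROOF-ONLY (0 definitions, 0 instances, 0 notation, no new named fact; nothing landed is edited or restated).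

WHAT.  abc-iut-L2-d4's leanest Thm. 5.7 (C)-displays (p509212 / p511909) carry, per family member `(a, b, w)` coherent with the constant anchor,
the binder `hK4famE′ = {(4) (K4m) at b} ∧ {(3) the shadow law for every PRODUCED base shadow}`.  `hK4famE'_of_shadow_byName` PRODUCES that
binder VERBATIM (same `(T, hT)` display device, same dictionary `(ι, hι, m, Facts, hpin)`) — for ANY self-equivalence `Ψ`, at the tower of the
Setting — from: (i) the dictionary identification PINNED, `ι` = the identity (`hιid`, heterogeneous because `T` is abstract; the §5 and §2 data share
`Π^tp_X̲̲` on the nose); (ii) residual (3) for the produced base shadows (`hK4famS` = `hK4famE′` minus (4), verbatim); (iii) THE K4 JUNCTION BOOK BY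
NAME at every level `M`, on the §5 datum `𝔉_M := ofConnectedTemperoidData (T := RD_M.toThetaEnvData) h (RD_M.levelStub id) l (R M) id …` over the
LEVEL-`M` RIGIDITY DATA `RD_M := Cu.rigidData (τ.mod M) hC hS h15iii L` (abc-iut-L2-t8): the v2 subquotient record `P_M` with its two pins, the
Kummer-determined rigidity family `(ρ_M, hB_M, hKD_M)` (`hB_M` «`B_M` is `(l, M)`-theta-saturated» at the level stub), the Δ-transport `aΨ_M`
(Thm. 5.6); (iv) per member «Thm. 5.6 at the transport `(a, b, w)`» (`hT56`, member data read through the roots `R`, `α`, `β` and the stub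
`S.sec5Stub h`): a base shadow `θ′` with T56-L09c `DeltaTransportCompatGal`, (K4β) at `b`, and ITS shadow law against the ONE tower `γ` (= (3) for
`θ′`); (v) `γ_μ` INDUCED by `γ` (`hind`) and the ONE Cor. 2.18 (i) `h218i` (F-0620 BY NAME).  (4) then follows from this seat's
`psiAut_symm_eq_gammaMu_atLevel_of_pins_galois` (p511389 ∘ abc-iut-w5-d051 p487842) with, DISCHARGED inside: the level-`M` descent of `γ`
(abc-iut-w5-d013 p438441; its `φΛ` = `γ_μ,M` by uniqueness of the induced family, p510157), `hH` (abc-iut-w5-d123 `stabilizer_base_comap_le_PiYdd`),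
Cor. 2.18 (i) at level `M` (`cor218_i_rigidData_iff`), and `Facts` along the stub field by field (`facts_levelStub_of_atLevel`).  DEVICE (recorded for
the lineage): `Exists.elim`, never `obtain`, on the member's existentials; conversions between the two stubs only inside the proof.
HONEST FRAMING: kernel-checked assembly of the cell's own typed theorems; the K4-book inputs, `hB_M`, F-0620 are DISPLAYED or FACT-policy labels, none
asserted inhabited at an actual curve (GAP G-w4d042g3-1); [EtTh] is refereed; typed ≠ discharged; no side taken on [IUTchIII] Cor. 3.12; nothing
here asserts abc proved or refuted.
-/

noncomputable section

namespace Literature.AnabelianGeometry.EtaleTheta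

open CategoryTheory Opposite FrobenioidCyclotomicRigidity Literature.AlgebraicGeometry.Frobenioids Literature.AnabelianGeometry.SemiGraphs
  Literature.AnabelianGeometry.SemiGraphs.GaloisObjects
open Literature.AlgebraicGeometry.Frobenioids.QuasiTemperoid (stabilizerSubgroup)

universe w v v' u u' u₀ v₀ u₁ v₁

namespace ThetaFrobenioidTower

section Setting

variable {p : ℕ} [Fact p.Prime] {DS : ThetaSetting p} {ES : DS.EtaleThetaData} {l' : ℕ} (Cu : ES.DoubleUnderline l')
  {e' : DS.toTemperedCurve.GroupLevelData} {Es : Set ℕ+} (τ : DS.CyclotomeTower l' Es) (hC : DS.Compat) (hS : DS.Sec2Hyps)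
  {D₀ : Type} [Category.{v₀} D₀] {T₀ : RealifiedDivisorMonoids (D₀ := D₀) treeMonoidVocab.{0}}
  {VD : FrdICatStub.{1, 0, 0} (ConnectedPart (BTemp (Cu.temperedArithmeticGroup e').Pi))}
  {tf : TemperedFrobenioid T₀ (ConnectedPart (BTemp (Cu.temperedArithmeticGroup e').Pi)) VD} {hZ : tf.monoidType = MonoidType.Z}
  {hP : ∀ A : (ConnectedPart (BTemp (Cu.temperedArithmeticGroup e').Pi))ᵒᵖ, IsPerfect (tf.Φ.carrier A)}
  {NH : Subgroup (Field.absoluteGaloisGroup DS.K) → tf.category → ℕ+ → Prop}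
  {pullFrac : ∀ {A A' : (BiKummerSetting.mkOfConnectedTemperoidYddTower (Cu.temperedArithmeticGroup e') tf hZ hP NH (Cu.thetaEnvTower τ hC hS)
    (ContinuousMulEquiv.refl _)).C} (_ : A' ⟶ A), (BiKummerSetting.mkOfConnectedTemperoidYddTower (Cu.temperedArithmeticGroup e') tf hZ hP NH
    (Cu.thetaEnvTower τ hC hS) (ContinuousMulEquiv.refl _)).biratUnits A → (BiKummerSetting.mkOfConnectedTemperoidYddTower
    (Cu.temperedArithmeticGroup e') tf hZ hP NH (Cu.thetaEnvTower τ hC hS) (ContinuousMulEquiv.refl _)).biratUnits A'}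
  {θ : (BiKummerSetting.mkOfConnectedTemperoidYddTower (Cu.temperedArithmeticGroup e') tf hZ hP NH (Cu.thetaEnvTower τ hC hS)
    (ContinuousMulEquiv.refl _)).biratUnits (BiKummerSetting.mkOfConnectedTemperoidYddTower (Cu.temperedArithmeticGroup e') tf hZ hP NH
    (Cu.thetaEnvTower τ hC hS) (ContinuousMulEquiv.refl _)).Aodot}
  {Bl : (BiKummerSetting.mkOfConnectedTemperoidYddTower (Cu.temperedArithmeticGroup e') tf hZ hP NH (Cu.thetaEnvTower τ hC hS)
    (ContinuousMulEquiv.refl _)).C}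
  {Pl : (BiKummerSetting.mkOfConnectedTemperoidYddTower (Cu.temperedArithmeticGroup e') tf hZ hP NH (Cu.thetaEnvTower τ hC hS)
    (ContinuousMulEquiv.refl _)).FractionPair θ Bl}
  {Rl : (BiKummerSetting.mkOfConnectedTemperoidYddTower (Cu.temperedArithmeticGroup e') tf hZ hP NH (Cu.thetaEnvTower τ hC hS)
    (ContinuousMulEquiv.refl _)).NthRoot θ Pl Cu.lPNat pullFrac}
  (h : ModelFrobenioid.Hypotheses tf.divisorMonoid tf.ratFnFunctor)
  (Q : FrobenioidTheta.ThetaSubquotientStub.{0} (ConnectedPart (BTemp (Cu.temperedArithmeticGroup e').Pi)))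
  (R : ∀ N : ℕ+, (BiKummerSetting.mkOfConnectedTemperoidYddTower (Cu.temperedArithmeticGroup e') tf hZ hP NH (Cu.thetaEnvTower τ hC hS)
    (ContinuousMulEquiv.refl _)).NthRoot Rl.root Rl.pair N pullFrac)
  (K' : Type) [Field K'] {X₀ : ConnectedPart (BTemp (Cu.temperedArithmeticGroup e').Pi)}
  (hX₀ : ∀ Y : ConnectedPart (BTemp (Cu.temperedArithmeticGroup e').Pi), Subsingleton (Y ⟶ X₀))
  (t : ∀ N : ℕ+, (R N).BN.base ⟶ X₀) (c₀ : K'ˣ →* (tf.ratFnFunctor.obj (op X₀))ˣ)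
  (hc₀ : Function.Injective c₀) (ht : ∀ N : ℕ+, Function.Injective (tf.ratFnFunctor.map (t N).op).hom)
  (hinvc : ∀ (N : ℕ+) (g : Aut (R N).AN.base), pull tf.divisorMonoid g.hom (ModelFrobenioid.div (R N).pair.num) = ModelFrobenioid.div (R
    N).pair.num)
  (hinvp : ∀ (N : ℕ+) (y : (Cu.thetaEnvTower τ hC hS).PiX), y ∈ (Cu.thetaEnvTower τ hC hS).PiYdd → pull tf.divisorMonoid
    ((BiKummerSetting.mkOfConnectedTemperoidYddTower (Cu.temperedArithmeticGroup e') tf hZ hP NH (Cu.thetaEnvTower τ hC hS) (ContinuousMulEquiv.refl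
    _)).galoisSurj (R N).AN.base (R N).αData.isGalois ((ContinuousMulEquiv.refl _) y)).hom (ModelFrobenioid.div (R N).pair.den) =
    ModelFrobenioid.div (R N).pair.den)
  (α : ∀ {N N' : ℕ+}, (N : ℕ) ∣ N' → ((R N').AN ⟶ (R N).AN))
  (β : ∀ {N N' : ℕ+}, (N : ℕ) ∣ N' → ((R N').BN ⟶ (R N).BN))
  (comm_sCap : ∀ {N N' : ℕ+} (hd : (N : ℕ) ∣ N'), (R N').pair.num ≫ β hd = α hd ≫ (R N).pair.num)
  (comm_sCup : ∀ {N N' : ℕ+} (hd : (N : ℕ) ∣ N'), (R N').pair.den ≫ β hd = α hd ≫ (R N).pair.den)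
  (isIsometry_α : ∀ {N N' : ℕ+} (hd : (N : ℕ) ∣ N'), ((BiKummerSetting.mkOfConnectedTemperoidYddTower (Cu.temperedArithmeticGroup e') tf hZ hP NH
    (Cu.thetaEnvTower τ hC hS) (ContinuousMulEquiv.refl _)).sec5Stub h).pre.IsIsometry (α hd))
  (degFr_α : ∀ {N N' : ℕ+} (hd : (N : ℕ) ∣ N'), (((BiKummerSetting.mkOfConnectedTemperoidYddTower (Cu.temperedArithmeticGroup e') tf hZ hP NH
    (Cu.thetaEnvTower τ hC hS) (ContinuousMulEquiv.refl _)).sec5Stub h).pre.degFr (α hd) : ℕ) * N = N')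
  (isIsometry_β : ∀ {N N' : ℕ+} (hd : (N : ℕ) ∣ N'), ((BiKummerSetting.mkOfConnectedTemperoidYddTower (Cu.temperedArithmeticGroup e') tf hZ hP NH
    (Cu.thetaEnvTower τ hC hS) (ContinuousMulEquiv.refl _)).sec5Stub h).pre.IsIsometry (β hd))
  (degFr_β : ∀ {N N' : ℕ+} (hd : (N : ℕ) ∣ N'), (((BiKummerSetting.mkOfConnectedTemperoidYddTower (Cu.temperedArithmeticGroup e') tf hZ hP NH
    (Cu.thetaEnvTower τ hC hS) (ContinuousMulEquiv.refl _)).sec5Stub h).pre.degFr (β hd) : ℕ) * N = N')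
  (baseFrob_α : ∀ {N N' : ℕ+} (hd : (N : ℕ) ∣ N'), (BiKummerSetting.mkOfConnectedTemperoidYddTower (Cu.temperedArithmeticGroup e') tf hZ hP NH
    (Cu.thetaEnvTower τ hC hS) (ContinuousMulEquiv.refl _)).IsOfBaseFrobeniusType (α hd))
  (h44 : BiKummerSetting.Thm44Hyp (BiKummerSetting.mkOfConnectedTemperoidYddTower (Cu.temperedArithmeticGroup e') tf hZ hP NH (Cu.thetaEnvTower τ hC
    hS) (ContinuousMulEquiv.refl _)) (BiKummerSetting.mkOfConnectedTemperoidYddTower (Cu.temperedArithmeticGroup e') tf hZ hP NH (Cu.thetaEnvTower τ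
    hC hS) (ContinuousMulEquiv.refl _)))
  (ψ : ∀ A : (BiKummerSetting.mkOfConnectedTemperoidYddTower (Cu.temperedArithmeticGroup e') tf hZ hP NH (Cu.thetaEnvTower τ hC hS)
    (ContinuousMulEquiv.refl _)).C, (BiKummerSetting.mkOfConnectedTemperoidYddTower (Cu.temperedArithmeticGroup e') tf hZ hP NH (Cu.thetaEnvTower τ
    hC hS) (ContinuousMulEquiv.refl _)).biratUnits A ≃* (BiKummerSetting.mkOfConnectedTemperoidYddTower (Cu.temperedArithmeticGroup e') tf hZ hP NH
    (Cu.thetaEnvTower τ hC hS) (ContinuousMulEquiv.refl _)).biratUnits (h44.Ψ.functor.obj A))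
  (hpull : ∀ {A A' : (BiKummerSetting.mkOfConnectedTemperoidYddTower (Cu.temperedArithmeticGroup e') tf hZ hP NH (Cu.thetaEnvTower τ hC hS)
    (ContinuousMulEquiv.refl _)).C} (φ : A' ⟶ A) (f : (BiKummerSetting.mkOfConnectedTemperoidYddTower (Cu.temperedArithmeticGroup e') tf hZ hP NH
    (Cu.thetaEnvTower τ hC hS) (ContinuousMulEquiv.refl _)).biratUnits A), ψ A' (pullFrac φ f) = pullFrac (h44.Ψ.functor.map φ) (ψ A f))
  (hii : BiKummerSetting.Thm44_ii h44 ψ) (h3 : h44.PreservesFrobeniusStructure) (h4b : h44.PreservesBaseFrobeniusTypeData)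
  (h8 : h44.PreservesAmple) (h15a : h44.PreservesFixedByHA ψ) (h15 : h44.PreservesSaturated ψ)
  (D : ∀ N : ℕ+, (BiKummerSetting.mkOfConnectedTemperoidYddTower (Cu.temperedArithmeticGroup e') tf hZ hP NH (Cu.thetaEnvTower τ hC hS)
    (ContinuousMulEquiv.refl _)).BaseFrobeniusTypeData (α (one_dvd_level N)))

/-- **`Facts` along the stub** (a structure, hence not definitionally shared across the two stubs, although each of its eight fields IS):
the §5 `Facts` at level `M` of the tower of the Setting give those of the §5 datum `𝔉_M` on the level-`M` rigidity-data stub.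
[cite: MochizukiEtTh2009, §5 p.330–331 (PDF pp.104–105)] -/
theorem facts_levelStub_of_atLevel (h15iii : DS.Prop15iii ES hC) (L : Cu.CuspLabels) (M : Es)
    (HF : ((ofThetaSettingFamily τ hC hS h Q R K' (fun N => (Units.map (tf.ratFnFunctor.map (t N).op).hom).comp c₀)
          (fun N => tf.unitsMap_comp_injective (t N) hc₀ (ht N)) hinvc (hinvp_family_ofConnectedTemperoidYddTower h R) α β comm_sCap comm_sCup
          isIsometry_α degFr_α isIsometry_β degFr_β baseFrob_α).atLevel M).Facts) :
    (ThetaFrobenioid.ofConnectedTemperoidData (T := (Cu.rigidData (τ.mod M) hC hS h15iii L).toThetaEnvData) h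
          ((Cu.rigidData (τ.mod M) hC hS h15iii L).levelStub (ContinuousMulEquiv.refl (Cu.temperedArithmeticGroup e').Pi)) Cu.odd_lPNat (R M)
          (ContinuousMulEquiv.refl (Cu.temperedArithmeticGroup e').Pi) K' ((Units.map (tf.ratFnFunctor.map (t M).op).hom).comp c₀)
          (tf.unitsMap_comp_injective (t M) hc₀ (ht M)) (hinvc M) (hinvp_family_ofConnectedTemperoidYddTower h R M)).Facts :=
  ⟨HF.sgpCapSpec, HF.sgpCupSpec, HF.strvSection, HF.biKummerDifferenceMem, HF.autAmpleBN, HF.constantsActByCyclotome, HF.epi_sCap, HF.epi_sCup⟩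

/-- **`hK4famE′` of the leanest Thm. 5.7 (C)-displays (p509212/p511909), VERBATIM, FROM THE K4 JUNCTION BOOK BY NAME + residual (3)** — for
any self-equivalence `Ψ`, with the dictionary identification pinned to the identity (`hιid`) and `γ_μ` induced by `γ`: per coherent member, (K4m) at
`b` is `psiAut_symm_eq_gammaMu_atLevel_of_pins_galois` (p511389 ∘ p487842) fed by `hT56` («Thm 5.6 at the transport»), the level book
`P_M`/pins/`(ρ_M, hB_M, hKD_M)`/`aΨ_M`, the descent of `γ` (p438441 + uniqueness), `hH` (`stabilizer_base_comap_le_PiYdd`), Cor. 2.18 (i) from the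
ONE `h218i`; the shadow law for the produced base shadows is `hK4famS` verbatim.
[cite: MochizukiEtTh2009, Thm 5.7 proof p.330 (PDF p.104); Thm 5.6 p.328–329 (PDF pp.102–103); Cor 2.18 (i) p.286 (PDF p.60)] -/
theorem hK4famE'_of_shadow_byName (h15iii : DS.Prop15iii ES hC) (L : Cu.CuspLabels)
    {N' : ℕ+} (μ' : DS.CyclotomeMod l' N') (h218i : (Cu.rigidData μ' hC hS h15iii L).Cor218_i)
    (Ψ : (BiKummerSetting.mkOfConnectedTemperoidYddTower (Cu.temperedArithmeticGroup e') tf hZ hP NH (Cu.thetaEnvTower τ hC hS)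
      (ContinuousMulEquiv.refl _)).C ≌
      (BiKummerSetting.mkOfConnectedTemperoidYddTower (Cu.temperedArithmeticGroup e') tf hZ hP NH (Cu.thetaEnvTower τ hC hS)
      (ContinuousMulEquiv.refl _)).C)
    (T : ThetaFrobenioidTower.{0} (BiKummerSetting.mkOfConnectedTemperoidYddTower (Cu.temperedArithmeticGroup e') tf hZ hP NH (Cu.thetaEnvTower τ hC
      hS) (ContinuousMulEquiv.refl _)).C (ConnectedPart (BTemp (Cu.temperedArithmeticGroup e').Pi)))
    (hT : T = ofThetaSettingFamily τ hC hS h Q R K' (fun N => (Units.map (tf.ratFnFunctor.map (t N).op).hom).comp c₀) (fun N =>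
      tf.unitsMap_comp_injective (t N) hc₀ (ht N)) hinvc (hinvp_family_ofConnectedTemperoidYddTower h R)
      α β comm_sCap comm_sCup isIsometry_α degFr_α isIsometry_β degFr_β baseFrob_α)
    (ι : T.PiX ≃* (Cu.thetaEnvTower τ hC hS).PiX) (hι : ∀ y : T.PiX, y ∈ T.PiYdd ↔ ι y ∈ (Cu.thetaEnvTower τ hC hS).PiYdd)
    (hιid : HEq ι (MulEquiv.refl (Cu.thetaEnvTower τ hC hS).PiX))
    (m : ∀ M : Es, (T.atLevel M).muTorsion (T.atLevel M).BN (T.atLevel M).N ≃* ((Cu.thetaEnvTower τ hC hS).level M).mu)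
    (HF : ∀ M : Es, (T.atLevel M).Facts)
    (η : ∀ M : Es, (Cu.thetaEnvTower τ hC hS).PiYdd → (Cu.thetaEnvTower τ hC hS).mu M)
    (hη : ∀ M, η M ∈ (Cu.thetaEnvTower τ hC hS).thetaCocycles M)
    (hpin : ∀ M : Es, (T.atLevel M).ThetaSectionCompat (HF M) ((Cu.thetaEnvTower τ hC hS).level M) ι (m M) hι (η M))
    (γ : (Cu.thetaEnvTower τ hC hS).PiX ≃ₜ* (Cu.thetaEnvTower τ hC hS).PiX) (γμ : ∀ M : Es, (Cu.thetaEnvTower τ hC hS).mu M ≃* (Cu.thetaEnvTower τ hC hS).mu M)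
    (hind : ∀ (M : Es) (g : (Cu.thetaEnvTower τ hC hS).lDeltaTheta) (hg : γ g ∈ (Cu.thetaEnvTower τ hC hS).lDeltaTheta),
      (Cu.thetaEnvTower τ hC hS).thetaMod M ⟨γ g, hg⟩ = γμ M ((Cu.thetaEnvTower τ hC hS).thetaMod M g))
    {Gal : ConnectedPart (BTemp (Cu.temperedArithmeticGroup e').Pi) → Prop}
    (P : ∀ M : Es, ThetaSubquotientProjGalois (ThetaFrobenioid.ofConnectedTemperoidData (T := (Cu.rigidData (τ.mod M) hC hS h15iii L).toThetaEnvData) h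
          ((Cu.rigidData (τ.mod M) hC hS h15iii L).levelStub (ContinuousMulEquiv.refl (Cu.temperedArithmeticGroup e').Pi)) Cu.odd_lPNat (R M)
          (ContinuousMulEquiv.refl (Cu.temperedArithmeticGroup e').Pi) K' ((Units.map (tf.ratFnFunctor.map (t M).op).hom).comp c₀)
          (tf.unitsMap_comp_injective (t M) hc₀ (ht M)) (hinvc M) (hinvp_family_ofConnectedTemperoidYddTower h R M)) Gal)
    (hPpre : ∀ M : Es, (P M).pre (R M).BN.base =
      (ThetaSubquotient.autPre ((Cu.rigidData (τ.mod M) hC hS h15iii L).qN (ContinuousMulEquiv.refl (Cu.temperedArithmeticGroup e').Pi))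
        (Cu.rigidData (τ.mod M) hC hS h15iii L).iotaN (R M).BN.base.obj).comap
          (Functor.mapAut (R M).BN.base (connectedObjects (BTemp (Cu.temperedArithmeticGroup e').Pi)).ι))
    (hPproj_pin : ∀ M : Es, haveI := (Cu.rigidData (τ.mod M) hC hS h15iii L).iotaN_range_normal
      ∀ (σ : (P M).pre (R M).BN.base)
        (t' : ThetaSubquotient.autPre ((Cu.rigidData (τ.mod M) hC hS h15iii L).qN (ContinuousMulEquiv.refl (Cu.temperedArithmeticGroup e').Pi))
          (Cu.rigidData (τ.mod M) hC hS h15iii L).iotaN (R M).BN.base.obj),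
        Functor.mapAut (R M).BN.base (connectedObjects (BTemp (Cu.temperedArithmeticGroup e').Pi)).ι (σ : Aut (R M).BN.base) =
            (t' : Aut (R M).BN.base.obj) →
          (((P M).proj (R M).BN.base σ : ThetaSubquotient.LDelta ((Cu.rigidData (τ.mod M) hC hS h15iii L).qN (ContinuousMulEquiv.refl (Cu.temperedArithmeticGroup e').Pi))
              (Cu.rigidData (τ.mod M) hC hS h15iii L).iotaN (R M).BN.base.obj)) =
            ThetaSubquotient.autProj ((Cu.rigidData (τ.mod M) hC hS h15iii L).qN (ContinuousMulEquiv.refl (Cu.temperedArithmeticGroup e').Pi))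
              (Cu.rigidData (τ.mod M) hC hS h15iii L).iotaN (R M).BN.base.obj t')
    (ρK : ∀ M : Es, RigidityFamily (ThetaFrobenioid.ofConnectedTemperoidData (T := (Cu.rigidData (τ.mod M) hC hS h15iii L).toThetaEnvData) h
          ((Cu.rigidData (τ.mod M) hC hS h15iii L).levelStub (ContinuousMulEquiv.refl (Cu.temperedArithmeticGroup e').Pi)) Cu.odd_lPNat (R M)
          (ContinuousMulEquiv.refl (Cu.temperedArithmeticGroup e').Pi) K' ((Units.map (tf.ratFnFunctor.map (t M).op).hom).comp c₀)
          (tf.unitsMap_comp_injective (t M) hc₀ (ht M)) (hinvc M) (hinvp_family_ofConnectedTemperoidYddTower h R M)))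
    (hB : ∀ M : Es, (ThetaFrobenioid.ofConnectedTemperoidData (T := (Cu.rigidData (τ.mod M) hC hS h15iii L).toThetaEnvData) h
          ((Cu.rigidData (τ.mod M) hC hS h15iii L).levelStub (ContinuousMulEquiv.refl (Cu.temperedArithmeticGroup e').Pi)) Cu.odd_lPNat (R M)
          (ContinuousMulEquiv.refl (Cu.temperedArithmeticGroup e').Pi) K' ((Units.map (tf.ratFnFunctor.map (t M).op).hom).comp c₀)
          (tf.unitsMap_comp_injective (t M) hc₀ (ht M)) (hinvc M) (hinvp_family_ofConnectedTemperoidYddTower h R M)).IsThetaSaturated (R M).BN)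
    (hKD : ∀ M : Es, (P M).IsKummerDetermined (ρK M) (hB M))
    (aΨ : ∀ (M : Es) (S), (ThetaFrobenioid.ofConnectedTemperoidData (T := (Cu.rigidData (τ.mod M) hC hS h15iii L).toThetaEnvData) h
          ((Cu.rigidData (τ.mod M) hC hS h15iii L).levelStub (ContinuousMulEquiv.refl (Cu.temperedArithmeticGroup e').Pi)) Cu.odd_lPNat (R M)
          (ContinuousMulEquiv.refl (Cu.temperedArithmeticGroup e').Pi) K' ((Units.map (tf.ratFnFunctor.map (t M).op).hom).comp c₀)
          (tf.unitsMap_comp_injective (t M) hc₀ (ht M)) (hinvc M) (hinvp_family_ofConnectedTemperoidYddTower h R M)).lDeltaModN S ≃* (ThetaFrobenioid.ofConnectedTemperoidData (T := (Cu.rigidData (τ.mod M) hC hS h15iii L).toThetaEnvData) h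
          ((Cu.rigidData (τ.mod M) hC hS h15iii L).levelStub (ContinuousMulEquiv.refl (Cu.temperedArithmeticGroup e').Pi)) Cu.odd_lPNat (R M)
          (ContinuousMulEquiv.refl (Cu.temperedArithmeticGroup e').Pi) K' ((Units.map (tf.ratFnFunctor.map (t M).op).hom).comp c₀)
          (tf.unitsMap_comp_injective (t M) hc₀ (ht M)) (hinvc M) (hinvp_family_ofConnectedTemperoidYddTower h R M)).lDeltaModN (Ψ.functor.obj S))
    (hT56 : ∀ (M : Es) (a : Ψ.functor.obj (R M).AN ≅ (R M).AN) (b : Ψ.functor.obj (R M).BN ≅ (R M).BN) (w : Aut (R M).BN),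
      w ∈ ((BiKummerSetting.mkOfConnectedTemperoidYddTower (Cu.temperedArithmeticGroup e') tf hZ hP NH (Cu.thetaEnvTower τ hC hS)
          (ContinuousMulEquiv.refl _)).sec5Stub h).pre.unitsSubgroup (R M).BN →
      a.inv ≫ Ψ.functor.map (R M).pair.num ≫ b.hom = (R M).pair.num →
      a.inv ≫ Ψ.functor.map (R M).pair.den ≫ b.hom = (R M).pair.den ≫ w.hom →
        ∃ θ' : Aut (R M).BN.base ≃* Aut (R M).BN.base,
          ThetaFrobenioid.Thm56Sub.DeltaTransportCompatGal (ThetaFrobenioid.ofConnectedTemperoidData (T := (Cu.rigidData (τ.mod M) hC hS h15iii L).toThetaEnvData) h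
          ((Cu.rigidData (τ.mod M) hC hS h15iii L).levelStub (ContinuousMulEquiv.refl (Cu.temperedArithmeticGroup e').Pi)) Cu.odd_lPNat (R M)
          (ContinuousMulEquiv.refl (Cu.temperedArithmeticGroup e').Pi) K' ((Units.map (tf.ratFnFunctor.map (t M).op).hom).comp c₀)
          (tf.unitsMap_comp_injective (t M) hc₀ (ht M)) (hinvc M) (hinvp_family_ofConnectedTemperoidYddTower h R M)) Ψ b (aΨ M) θ' (P M) ∧
          (∀ y, (ThetaFrobenioid.ofConnectedTemperoidData (T := (Cu.rigidData (τ.mod M) hC hS h15iii L).toThetaEnvData) h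
          ((Cu.rigidData (τ.mod M) hC hS h15iii L).levelStub (ContinuousMulEquiv.refl (Cu.temperedArithmeticGroup e').Pi)) Cu.odd_lPNat (R M)
          (ContinuousMulEquiv.refl (Cu.temperedArithmeticGroup e').Pi) K' ((Units.map (tf.ratFnFunctor.map (t M).op).hom).comp c₀)
          (tf.unitsMap_comp_injective (t M) hc₀ (ht M)) (hinvc M) (hinvp_family_ofConnectedTemperoidYddTower h R M)).psiAut Ψ b (ρK M (R M).BN (hB M) y).1 =
            (ρK M (R M).BN (hB M) ((ThetaFrobenioid.ofConnectedTemperoidData (T := (Cu.rigidData (τ.mod M) hC hS h15iii L).toThetaEnvData) h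
          ((Cu.rigidData (τ.mod M) hC hS h15iii L).levelStub (ContinuousMulEquiv.refl (Cu.temperedArithmeticGroup e').Pi)) Cu.odd_lPNat (R M)
          (ContinuousMulEquiv.refl (Cu.temperedArithmeticGroup e').Pi) K' ((Units.map (tf.ratFnFunctor.map (t M).op).hom).comp c₀)
          (tf.unitsMap_comp_injective (t M) hc₀ (ht M)) (hinvc M) (hinvp_family_ofConnectedTemperoidYddTower h R M)).lDeltaModNMap b.hom (aΨ M (R M).BN y))).1) ∧
          ∀ k : (Cu.thetaEnvTower τ hC hS).PiYdd,
            θ' ((ofThetaSettingFamily τ hC hS h Q R K' (fun N => (Units.map (tf.ratFnFunctor.map (t N).op).hom).comp c₀)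
          (fun N => tf.unitsMap_comp_injective (t N) hc₀ (ht N)) hinvc (hinvp_family_ofConnectedTemperoidYddTower h R) α β comm_sCap comm_sCup
          isIsometry_α degFr_α isIsometry_β degFr_β baseFrob_α).ρ M (k : (Cu.thetaEnvTower τ hC hS).PiX)) =
              (ofThetaSettingFamily τ hC hS h Q R K' (fun N => (Units.map (tf.ratFnFunctor.map (t N).op).hom).comp c₀)
          (fun N => tf.unitsMap_comp_injective (t N) hc₀ (ht N)) hinvc (hinvp_family_ofConnectedTemperoidYddTower h R) α β comm_sCap comm_sCup
          isIsometry_α degFr_α isIsometry_β degFr_β baseFrob_α).ρ M (γ (k : (Cu.thetaEnvTower τ hC hS).PiX)))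
    (hK4famS : ∀ (α₁ : Ψ.functor.obj (T.AN 1) ≅ T.AN 1) (β₁ : Ψ.functor.obj (T.BN 1) ≅ T.BN 1) (u₁ : Aut (T.BN 1))
      (hu₁ : u₁ ∈ (T.atLevel 1).units (T.BN 1)),
      α₁.inv ≫ Ψ.functor.map (T.sCap 1) ≫ β₁.hom = T.sCap 1 →
      α₁.inv ≫ Ψ.functor.map (T.sCup 1) ≫ β₁.hom = T.sCup 1 ≫ u₁.hom →
      ∀ c : T.Kˣ, (T.atLevel 1).unitsToBirat (T.BN 1) ⟨u₁, hu₁⟩ = T.constEmb 1 c →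
      ∀ N (hN : N ∈ Es), ∀ (a : Ψ.functor.obj (T.AN N) ≅ T.AN N) (b : Ψ.functor.obj (T.BN N) ≅ T.BN N) (w : Aut (T.BN N)),
        w ∈ (T.atLevel N).units (T.BN N) →
        a.inv ≫ Ψ.functor.map (T.sCap N) ≫ b.hom = T.sCap N →
        a.inv ≫ Ψ.functor.map (T.sCup N) ≫ b.hom = T.sCup N ≫ w.hom →
        a.inv ≫ Ψ.functor.map (T.α (one_dvd_level N)) ≫ α₁.hom = T.α (one_dvd_level N) →
        b.inv ≫ Ψ.functor.map (T.β (one_dvd_level N)) ≫ β₁.hom = T.β (one_dvd_level N) →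
          ∀ (θb : Aut (T.pre.base.obj (T.BN N)) ≃* Aut (T.pre.base.obj (T.BN N))) (e : T.AN N ≅ T.AN N),
            e ∈ (T.atLevel N).units (T.AN N) → ∀ Dc Dp : Aut (T.BN N),
            a.inv ≫ Ψ.functor.map (T.sCap N) ≫ (b ≪≫ Dc.symm).hom = e.hom ≫ T.sCap N ≫ (1 : Aut (T.BN N)).hom →
            a.inv ≫ Ψ.functor.map (T.sCup N) ≫ (b ≪≫ Dc.symm).hom = e.hom ≫ T.sCup N ≫ Dp.hom →
            Dp ∈ (T.atLevel N).units (T.BN N) → (T.atLevel N).StrvTransport Ψ a e θb →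
            (T.atLevel N).HB.map θb.toMonoidHom = (T.atLevel N).HB →
              ∀ k : T.PiYdd, θb (T.ρ N k) = T.ρ N (ι.symm (γ (ι k))))
 :
    ∀ (α₁ : Ψ.functor.obj (T.AN 1) ≅ T.AN 1) (β₁ : Ψ.functor.obj (T.BN 1) ≅ T.BN 1) (u₁ : Aut (T.BN 1))
      (hu₁ : u₁ ∈ (T.atLevel 1).units (T.BN 1)),
      α₁.inv ≫ Ψ.functor.map (T.sCap 1) ≫ β₁.hom = T.sCap 1 →
      α₁.inv ≫ Ψ.functor.map (T.sCup 1) ≫ β₁.hom = T.sCup 1 ≫ u₁.hom →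
      ∀ c : T.Kˣ, (T.atLevel 1).unitsToBirat (T.BN 1) ⟨u₁, hu₁⟩ = T.constEmb 1 c →
      ∀ N (hN : N ∈ Es), ∀ (a : Ψ.functor.obj (T.AN N) ≅ T.AN N) (b : Ψ.functor.obj (T.BN N) ≅ T.BN N) (w : Aut (T.BN N)),
        w ∈ (T.atLevel N).units (T.BN N) →
        a.inv ≫ Ψ.functor.map (T.sCap N) ≫ b.hom = T.sCap N →
        a.inv ≫ Ψ.functor.map (T.sCup N) ≫ b.hom = T.sCup N ≫ w.hom →
        a.inv ≫ Ψ.functor.map (T.α (one_dvd_level N)) ≫ α₁.hom = T.α (one_dvd_level N) →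
        b.inv ≫ Ψ.functor.map (T.β (one_dvd_level N)) ≫ β₁.hom = T.β (one_dvd_level N) →
          (∀ x : (Cu.thetaEnvTower τ hC hS).mu ⟨N, hN⟩, (T.atLevel N).psiAut Ψ b
                (((m ⟨N, hN⟩).symm x : (T.atLevel N).muTorsion (T.atLevel N).BN (T.atLevel N).N) : Aut (T.atLevel N).BN) =
              (((m ⟨N, hN⟩).symm (γμ ⟨N, hN⟩ x) : (T.atLevel N).muTorsion (T.atLevel N).BN (T.atLevel N).N) :
                Aut (T.atLevel N).BN)) ∧
          ∀ (θb : Aut (T.pre.base.obj (T.BN N)) ≃* Aut (T.pre.base.obj (T.BN N))) (e : T.AN N ≅ T.AN N),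
            e ∈ (T.atLevel N).units (T.AN N) → ∀ Dc Dp : Aut (T.BN N),
            a.inv ≫ Ψ.functor.map (T.sCap N) ≫ (b ≪≫ Dc.symm).hom = e.hom ≫ T.sCap N ≫ (1 : Aut (T.BN N)).hom →
            a.inv ≫ Ψ.functor.map (T.sCup N) ≫ (b ≪≫ Dc.symm).hom = e.hom ≫ T.sCup N ≫ Dp.hom →
            Dp ∈ (T.atLevel N).units (T.BN N) → (T.atLevel N).StrvTransport Ψ a e θb →
            (T.atLevel N).HB.map θb.toMonoidHom = (T.atLevel N).HB →
              ∀ k : T.PiYdd, θb (T.ρ N k) = T.ρ N (ι.symm (γ (ι k))) := by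
  subst hT
  have hι₀ := eq_of_heq hιid
  subst hι₀
  intro α₁ β₁ u₁ hu₁ h₁ h₂ c hc N hN a b w hw hTa hTb hΨa hΨb
  refine ⟨fun x => ?_, hK4famS α₁ β₁ u₁ hu₁ h₁ h₂ c hc N hN a b w hw hTa hTb hΨa hΨb⟩
  -- (4) (K4m) at `b` from the K4 junction book at the level-`N` rigidity data (p511389 ∘ p487842)
  haveI := (Cu.rigidData (τ.mod ⟨N, hN⟩) hC hS h15iii L).iotaN_range_normal
  have h218iN : (Cu.rigidData (τ.mod ⟨N, hN⟩) hC hS h15iii L).Cor218_i :=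
    (Cu.cor218_i_rigidData_iff hC hS h15iii L μ' (τ.mod ⟨N, hN⟩)).1 h218i
  have hLΔ := Cu.map_lDeltaTheta_thetaEnvTower_of_cor218i τ hC hS h15iii L μ' h218i γ
  refine (hT56 ⟨N, hN⟩ a b w hw hTa hTb).elim fun θ' hθ' => ?_
  -- the level-`N` descent of `γ` (p438441); its `φΛ` IS the induced `γ_μ,N` (uniqueness of the induced family)
  refine ((Cu.rigidData (τ.mod ⟨N, hN⟩) hC hS h15iii L).exists_levelTwistData_of_cor218 h218iN
    (ContinuousMulEquiv.refl (Cu.temperedArithmeticGroup e').Pi) γ).elim fun φQ hφQ => hφQ.elim fun φΛ hφ => ?_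
  have hΛeq : φΛ = γμ ⟨N, hN⟩ := MulEquiv.ext fun tt => by
    obtain ⟨g, rfl⟩ := (Cu.thetaEnvTower τ hC hS).thetaMod_surjective ⟨N, hN⟩ tt
    exact (hφ.2.2.1 g (hLΔ g g.2)).trans (hind ⟨N, hN⟩ g (hLΔ g g.2))
  have hιN : ∀ a' : (Cu.thetaEnvTower τ hC hS).mu ⟨N, hN⟩, (Cu.rigidData (τ.mod ⟨N, hN⟩) hC hS h15iii L).iotaN (γμ ⟨N, hN⟩ a') = φQ ((Cu.rigidData (τ.mod ⟨N, hN⟩) hC hS h15iii L).iotaN a') :=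
    fun a' => by rw [← hΛeq]; exact hφ.2.1 a'
  exact psiAut_symm_eq_gammaMu_atLevel_of_pins_galois τ hC hS h Q R K' (fun N => (Units.map (tf.ratFnFunctor.map (t N).op).hom).comp c₀)
    (fun N => tf.unitsMap_comp_injective (t N) hc₀ (ht N)) hinvc (hinvp_family_ofConnectedTemperoidYddTower h R) α β comm_sCap comm_sCup
    isIsometry_α degFr_α isIsometry_β degFr_β baseFrob_α h15iii L ⟨N, hN⟩ (P ⟨N, hN⟩) (hPpre ⟨N, hN⟩) (hPproj_pin ⟨N, hN⟩)
    (ThetaFrobenioid.stabilizer_base_comap_le_PiYdd (T := (Cu.thetaEnvTower τ hC hS).level ⟨N, hN⟩)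
      (ιX := ContinuousMulEquiv.refl (Cu.temperedArithmeticGroup e').Pi) (R N))
    (facts_levelStub_of_atLevel Cu τ hC hS h Q R K' t c₀ hc₀ ht hinvc α β comm_sCap comm_sCup isIsometry_α degFr_α isIsometry_β degFr_β
      baseFrob_α h15iii L ⟨N, hN⟩ (HF ⟨N, hN⟩)) (m ⟨N, hN⟩) hι (hη ⟨N, hN⟩) (hpin ⟨N, hN⟩)
    (hKD ⟨N, hN⟩) Ψ b (aΨ ⟨N, hN⟩) θ' hθ'.1 γ φQ (γμ ⟨N, hN⟩) hφ.1 hιN h218iN hθ'.2.2 hθ'.2.1 x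

end Setting

end ThetaFrobenioidTower

end Literature.AnabelianGeometry.EtaleTheta

end
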